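import Summits.BirchSwinnertonDyer.BirchSwinnertonDyer.Theorems.Rank2Observatory2DescClRealCertE2SQMain
import HarnessLib

/-!
# BirchSwinnertonDyer — rank ≥ 2 observatory: KERNEL-2DESC-CL, SQ5 — `rank E(ℚ) = r` WRAPPERS OVER A TOTALLY SPLIT `q`

HONEST FRAMING: per-curve certified theorems and census instruments; no claim on BSD in rank ≥ 2.

Fifth generic file of the split-`q` variant (design `…/kernel-2desc-cl/v2/generics/cq/PLAN-g51.md`): from the rank
bound `rank_le_of_checkE3R` (SQ5a, `…ClRealCertE2SQMain`) and a tree lower bound, `rank_eq_of_checkE3R` and the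
`K`-free row wrappers `rank_eq_of_certsE3R`, `_scaled`, `_complSq`, `_plain` over the model `CubicField a b c`; the
model plumbing (completed square rescaled by `d`) is isolated once as `mordellWeilRank_complSq_scaled` for reuse by
refined checkers (e.g. `…ClCurveCertE3N`).

Sorry-free; axioms `propext`, `Classical.choice`, `Quot.sound`.
[cite: Cassels1991LecturesEllipticCurves, §15] [cite: CremonaAlgorithms1997, §3.6] [cite: SilvermanAEC2009, III.3.1(b)]
-/

set_option linter.dupNamespace false

noncomputable section

open scoped Classical NumberField nonZeroDivisors

open Literature.NumberTheory.NumberFields Polynomial Module NumberField IsDedekindDomain Ideal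

namespace Summit.BirchSwinnertonDyer.BirchSwinnertonDyer.Rank2Observatory.TwoDescCl

open TwoDescCubic ClFieldCert

/-! ## Model plumbing (checker-independent) -/

section Model

/-- **Completed square, rescaled**: the rank of `(a₁, a₂, a₃, a₄, a₆)` equals the rank of
`(0, d²(a₁² + 4a₂), 0, 8d⁴(a₁a₃ + 2a₄), 16d⁶(a₃² + 4a₆))` for `d ≠ 0` (both variable changes preserve the rank).
[cite: SilvermanAEC2009, III.3.1(b)] [cite: CremonaAlgorithms1997, §3.6] -/
theorem mordellWeilRank_complSq_scaled (a₁ a₂ a₃ a₄ a₆ d : ℤ) (hd : d ≠ 0) :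
    (((⟨a₁, a₂, a₃, a₄, a₆⟩ : WeierstrassCurve ℤ)).map (Int.castRingHom ℚ)).mordellWeilRank =
      (((⟨0, d ^ 2 * (a₁ ^ 2 + 4 * a₂), 0, d ^ 4 * (8 * (a₁ * a₃ + 2 * a₄)), d ^ 6 * (16 * (a₃ ^ 2 + 4 * a₆))⟩ :
        WeierstrassCurve ℤ)).map (Int.castRingHom ℚ)).mordellWeilRank := by
  -- completed square
  have hV : ((⟨0, a₁ ^ 2 + 4 * a₂, 0, 8 * (a₁ * a₃ + 2 * a₄), 16 * (a₃ ^ 2 + 4 * a₆)⟩ : WeierstrassCurve ℤ)).map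
        (Int.castRingHom ℚ) =
      (⟨Units.mk0 (1 / 2 : ℚ) (by norm_num), 0, -(a₁ : ℚ) / 2, -(a₃ : ℚ) / 2⟩ :
        WeierstrassCurve.VariableChange ℚ) •
        (((⟨a₁, a₂, a₃, a₄, a₆⟩ : WeierstrassCurve ℤ)).map (Int.castRingHom ℚ)) := by
    ext <;> simp only [WeierstrassCurve.map_a₁, WeierstrassCurve.map_a₂, WeierstrassCurve.map_a₃,
      WeierstrassCurve.map_a₄, WeierstrassCurve.map_a₆, WeierstrassCurve.variableChange_a₁,
      WeierstrassCurve.variableChange_a₂, WeierstrassCurve.variableChange_a₃,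
      WeierstrassCurve.variableChange_a₄, WeierstrassCurve.variableChange_a₆, Units.val_inv_eq_inv_val,
      Units.val_mk0, eq_intCast, Int.cast_zero] <;> push_cast <;> ring
  have hr₁ : (((⟨0, a₁ ^ 2 + 4 * a₂, 0, 8 * (a₁ * a₃ + 2 * a₄), 16 * (a₃ ^ 2 + 4 * a₆)⟩ : WeierstrassCurve ℤ)).map
        (Int.castRingHom ℚ)).mordellWeilRank =
      (((⟨a₁, a₂, a₃, a₄, a₆⟩ : WeierstrassCurve ℤ)).map (Int.castRingHom ℚ)).mordellWeilRank := by
    rw [hV]; exact WeierstrassCurve.mordellWeilRank_variableChange_holds _ _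
  -- rescaling
  have hS : scaleModel (⟨0, a₁ ^ 2 + 4 * a₂, 0, 8 * (a₁ * a₃ + 2 * a₄), 16 * (a₃ ^ 2 + 4 * a₆)⟩ :
      WeierstrassCurve ℤ) d =
      ⟨0, d ^ 2 * (a₁ ^ 2 + 4 * a₂), 0, d ^ 4 * (8 * (a₁ * a₃ + 2 * a₄)), d ^ 6 * (16 * (a₃ ^ 2 + 4 * a₆))⟩ := by
    simp only [scaleModel, mul_zero]
  have hr₂ := mordellWeilRank_scaleModel
    (⟨0, a₁ ^ 2 + 4 * a₂, 0, 8 * (a₁ * a₃ + 2 * a₄), 16 * (a₃ ^ 2 + 4 * a₆)⟩ : WeierstrassCurve ℤ) hd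
  rw [hS] at hr₂
  rw [← hr₁, ← hr₂]

end Model

section Sound

variable {K : Type*} [Field K] [NumberField K] {θ : K}

/-- **`rank E(ℚ) = r`** (totally real two-view field) from the checked records and a tree lower bound.
[cite: CremonaAlgorithms1997, §3.6] -/
theorem rank_eq_of_checkE3R (r : ℕ) (G : ClFieldCertRE2)
    (hθ : aeval θ (MonicCubic.poly G.toE2.fe.base.a G.toE2.fe.base.b G.toE2.fe.base.c) = 0)
    (h3 : finrank ℚ K = 3) (h2 : G.check2R3 = true) (hpr : G.toE2.fe.primeListE.Forall Nat.Prime)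
    (ccr : ClCurveCertE3R) (hc : checkE3R G ccr r = true)
    (hlow : r ≤ (((⟨0, ccr.cc.A, 0, ccr.cc.B, ccr.cc.C⟩ : WeierstrassCurve ℤ)).map
      (Int.castRingHom ℚ)).mordellWeilRank) :
    (((⟨0, ccr.cc.A, 0, ccr.cc.B, ccr.cc.C⟩ : WeierstrassCurve ℤ)).map (Int.castRingHom ℚ)).mordellWeilRank =
      r := by
  have hV : ((⟨0, ccr.cc.A, 0, ccr.cc.B, ccr.cc.C⟩ : WeierstrassCurve ℤ)).map (Int.castRingHom ℚ) =
      (⟨0, ccr.cc.A, 0, ccr.cc.B, ccr.cc.C⟩ : WeierstrassCurve ℚ) := by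
    ext <;> simp [WeierstrassCurve.map]
  refine le_antisymm ?_ hlow
  rw [hV]
  exact rank_le_of_checkE3R r G hθ h3 h2 hpr ccr hc

end Sound

/-! ## `K`-free wrappers over the model `CubicField a b c` -/

section Rows

/-- **`rank E(ℚ) = r` from the two records** (model `(0, A, 0, B, C)`, totally real two-view field with multipliers).
[cite: Cassels1991LecturesEllipticCurves, §15] [cite: CremonaAlgorithms1997, §3.6] -/
theorem rank_eq_of_certsE3R (r : ℕ) (G : ClFieldCertRE2) (ccr : ClCurveCertE3R) (h2 : G.check2R3 = true)
    (hpr : G.toE2.fe.primeListE.Forall Nat.Prime) (hc : checkE3R G ccr r = true)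
    (hlow : r ≤ (((⟨0, ccr.cc.A, 0, ccr.cc.B, ccr.cc.C⟩ : WeierstrassCurve ℤ)).map
      (Int.castRingHom ℚ)).mordellWeilRank) :
    (((⟨0, ccr.cc.A, 0, ccr.cc.B, ccr.cc.C⟩ : WeierstrassCurve ℤ)).map (Int.castRingHom ℚ)).mordellWeilRank =
      r := by
  haveI : Fact (Irreducible (MonicCubic.polyQ G.toE2.fe.base.a G.toE2.fe.base.b G.toE2.fe.base.c)) :=
    ⟨G.toE2.fe.base.irreducible_of_reg3 (G.toE2.fe.checkReg3_of_coreE3 (G.checkCoreE3_of_check2R3 h2))⟩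
  exact rank_eq_of_checkE3R (K := CubicField G.toE2.fe.base.a G.toE2.fe.base.b G.toE2.fe.base.c) r G
    (CubicField.aeval_root _ _ _) (CubicField.finrank_eq _ _ _) h2 hpr ccr hc hlow

/-- **`rank E(ℚ) = r` for the ORIGINAL model** `(a₁, a₂, a₃, a₄, a₆)` when the records certify its
completed-square model RESCALED by `d` — `(0, d²(a₁² + 4a₂), 0, 8d⁴(a₁a₃ + 2a₄), 16d⁶(a₃² + 4a₆))` — (rank is
invariant under both variable changes; `d = 1` is the plain completed square). [cite: CremonaAlgorithms1997, §3.6]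
[cite: SilvermanAEC2009, III.3.1(b)] -/
theorem rank_eq_of_certsE3R_scaled (r : ℕ) (G : ClFieldCertRE2) (ccr : ClCurveCertE3R) (h2 : G.check2R3 = true)
    (hpr : G.toE2.fe.primeListE.Forall Nat.Prime) (hc : checkE3R G ccr r = true) (a₁ a₂ a₃ a₄ a₆ d : ℤ)
    (hd : d ≠ 0)
    (hABC : ccr.cc.A = d ^ 2 * (a₁ ^ 2 + 4 * a₂) ∧ ccr.cc.B = d ^ 4 * (8 * (a₁ * a₃ + 2 * a₄)) ∧
      ccr.cc.C = d ^ 6 * (16 * (a₃ ^ 2 + 4 * a₆)))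
    (hlow : r ≤ (((⟨a₁, a₂, a₃, a₄, a₆⟩ : WeierstrassCurve ℤ)).map (Int.castRingHom ℚ)).mordellWeilRank) :
    (((⟨a₁, a₂, a₃, a₄, a₆⟩ : WeierstrassCurve ℤ)).map (Int.castRingHom ℚ)).mordellWeilRank = r := by
  obtain ⟨hA, hB, hC⟩ := hABC
  rw [mordellWeilRank_complSq_scaled a₁ a₂ a₃ a₄ a₆ d hd, ← hA, ← hB, ← hC] at hlow ⊢
  exact rank_eq_of_certsE3R r G ccr h2 hpr hc hlow

/-- The plain completed-square shape (`d = 1`). [cite: CremonaAlgorithms1997, §3.6] -/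
theorem rank_eq_of_certsE3R_complSq (r : ℕ) (G : ClFieldCertRE2) (ccr : ClCurveCertE3R) (h2 : G.check2R3 = true)
    (hpr : G.toE2.fe.primeListE.Forall Nat.Prime) (hc : checkE3R G ccr r = true) (a₁ a₂ a₃ a₄ a₆ : ℤ)
    (hABC : ccr.cc.A = a₁ ^ 2 + 4 * a₂ ∧ ccr.cc.B = 8 * (a₁ * a₃ + 2 * a₄) ∧ ccr.cc.C = 16 * (a₃ ^ 2 + 4 * a₆))
    (hlow : r ≤ (((⟨a₁, a₂, a₃, a₄, a₆⟩ : WeierstrassCurve ℤ)).map (Int.castRingHom ℚ)).mordellWeilRank) :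
    (((⟨a₁, a₂, a₃, a₄, a₆⟩ : WeierstrassCurve ℤ)).map (Int.castRingHom ℚ)).mordellWeilRank = r :=
  rank_eq_of_certsE3R_scaled r G ccr h2 hpr hc a₁ a₂ a₃ a₄ a₆ 1 one_ne_zero
    (by obtain ⟨hA, hB, hC⟩ := hABC; exact ⟨by rw [hA]; ring, by rw [hB]; ring, by rw [hC]; ring⟩) hlow

/-- Row plumbing for a curve already given by a plain model `y² = x³ + a₂x² + a₄x + a₆` (`a₁ = a₃ = 0`): the record's
cubic IS the curve. [cite: Cassels1991LecturesEllipticCurves, §15] -/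
theorem rank_eq_of_certsE3R_plain (r : ℕ) (G : ClFieldCertRE2) (ccr : ClCurveCertE3R) (h2 : G.check2R3 = true)
    (hpr : G.toE2.fe.primeListE.Forall Nat.Prime) (hc : checkE3R G ccr r = true) (a₂ a₄ a₆ : ℤ)
    (hABC : ccr.cc.A = a₂ ∧ ccr.cc.B = a₄ ∧ ccr.cc.C = a₆)
    (hlow : r ≤ (((⟨0, a₂, 0, a₄, a₆⟩ : WeierstrassCurve ℤ)).map (Int.castRingHom ℚ)).mordellWeilRank) :
    (((⟨0, a₂, 0, a₄, a₆⟩ : WeierstrassCurve ℤ)).map (Int.castRingHom ℚ)).mordellWeilRank = r := by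
  obtain ⟨rfl, rfl, rfl⟩ := hABC
  exact rank_eq_of_certsE3R r G ccr h2 hpr hc hlow

end Rows

end Summit.BirchSwinnertonDyer.BirchSwinnertonDyer.Rank2Observatory.TwoDescCl

end
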